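import Literature.MathematicalPhysics.QuantumManyBody.DyadicCoherentFractionRefinement
import Literature.MathematicalPhysics.QuantumManyBody.BoseGasProductState
import Literature.MathematicalPhysics.QuantumManyBody.OneParticleMarginals

/-!
# Route `BECDyadicChaining` — crux `BaseCoherentMass` (stmt-AtomisticToContinuum-13193), stub `stub_occupationLeDensity`

A flat-mode occupation is at most the expected number of particles in its cell: for every Dirichlet
trial state `Ψ ∈ TrialState N L`, every dyadic level `K` and every cell index `i`,
`⟨φ_B, γ_Ψ φ_B⟩ ≤ Σ_j ∫_{X_j ∈ B} |Ψ|²` for the flat mode `φ_B = (s³)^{-1/2} 1_B` of the half-open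
dyadic cell `B = dyCell L K i` of side `s = L/2^K` (the diagonal of the one-particle density matrix is
the one-particle density, [LSSY2005, §1.2 (1.17)–(1.18)]).

Proof. For `N = n + 1` and `L > 0`,
`⟨φ_B, γ_Ψ φ_B⟩ = (n+1) ∫ dY |(s³)^{-1/2} ∫_B Ψ(x,Y) dx|² ≤ (n+1) ∫ dY ∫_B |Ψ(x,Y)|² dx`
(Cauchy–Schwarz in the cell, `|B| = s³`; `occupation_dyMode_le_mul_setLIntegral`), and by Tonelli over
the first particle the right side is `(n+1) ∫_{X 0 ∈ B} |Ψ|²` (`lintegral_setLIntegral_vecCons`);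
Bose symmetry (`X ↦ X ∘ swap 0 j` preserves Lebesgue measure and `Ψ`, `setLIntegral_coord_mem_eq`)
turns `(n+1) ∫_{X 0 ∈ B} |Ψ|²` into `Σ_j ∫_{X j ∈ B} |Ψ|²`. For `N = 0` or `L ≤ 0` the occupation
vanishes. No new definitions; everything is over `Literature.MathematicalPhysics.QuantumManyBody.BoseGas`
(`occupation`, `TrialState`, `dyCell`, `dyMode`).
-/

noncomputable section

namespace Summit.AtomisticToContinuum.BoseEinsteinCondensation.Theorems.BaseCoherentMass

open MeasureTheory
open scoped ENNReal NNReal ComplexConjugate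
open Literature.MathematicalPhysics.QuantumManyBody.BoseGas

/-- **Bose symmetry of the one-particle cell masses.** For a permutation-symmetric `Ψ` and a
measurable `B ⊆ ℝ³`, the mass of `{X | X j ∈ B}` under `|Ψ|² dX` is the same for every particle `j`
(relabelling `X ↦ X ∘ swap 0 j` preserves Lebesgue measure and `Ψ`). [folklore] -/
theorem setLIntegral_coord_mem_eq {n : ℕ} {Ψ : Config (n + 1) → ℂ}
    (hsymm : ∀ (σ : Equiv.Perm (Fin (n + 1))) (X : Config (n + 1)), Ψ (X ∘ σ) = Ψ X)
    {B : Set Space} (hB : MeasurableSet B) (j : Fin (n + 1)) :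
    ∫⁻ X in {X : Config (n + 1) | X j ∈ B}, (‖Ψ X‖₊ : ℝ≥0∞) ^ 2 =
      ∫⁻ X in {X : Config (n + 1) | X 0 ∈ B}, (‖Ψ X‖₊ : ℝ≥0∞) ^ 2 := by
  have hSj : MeasurableSet {X : Config (n + 1) | X j ∈ B} := measurable_pi_apply j hB
  have hS0 : MeasurableSet {X : Config (n + 1) | X 0 ∈ B} := measurable_pi_apply 0 hB
  rw [← lintegral_indicator hSj, ← lintegral_indicator hS0,
    ← lintegral_comp_perm (Equiv.swap 0 j)
      ({X : Config (n + 1) | X 0 ∈ B}.indicator fun X => (‖Ψ X‖₊ : ℝ≥0∞) ^ 2)]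
  refine lintegral_congr fun X => ?_
  by_cases hX : X j ∈ B
  · have hXj : X ∈ {X : Config (n + 1) | X j ∈ B} := hX
    have hX0 : X ∘ Equiv.swap 0 j ∈ {X : Config (n + 1) | X 0 ∈ B} := by
      simpa only [Set.mem_setOf_eq, Function.comp_apply, Equiv.swap_apply_left] using hX
    rw [Set.indicator_of_mem hXj, Set.indicator_of_mem hX0, hsymm]
  · have hXj : X ∉ {X : Config (n + 1) | X j ∈ B} := hX
    have hX0 : X ∘ Equiv.swap 0 j ∉ {X : Config (n + 1) | X 0 ∈ B} := by
      simpa only [Set.mem_setOf_eq, Function.comp_apply, Equiv.swap_apply_left] using hX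
    rw [Set.indicator_of_notMem hXj, Set.indicator_of_notMem hX0]

/-- **Tonelli over the first particle, restricted to a cell.** For measurable `Ψ` and `B ⊆ ℝ³`:
`∫ dY ∫_B |Ψ(x, Y)|² dx = ∫_{X 0 ∈ B} |Ψ(X)|² dX`. [folklore] -/
theorem lintegral_setLIntegral_vecCons {n : ℕ} {Ψ : Config (n + 1) → ℂ} (hΨ : Measurable Ψ)
    {B : Set Space} (hB : MeasurableSet B) :
    ∫⁻ Y : Config n, ∫⁻ x in B, (‖Ψ (Matrix.vecCons x Y)‖₊ : ℝ≥0∞) ^ 2 =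
      ∫⁻ X in {X : Config (n + 1) | X 0 ∈ B}, (‖Ψ X‖₊ : ℝ≥0∞) ^ 2 := by
  have hS0 : MeasurableSet {X : Config (n + 1) | X 0 ∈ B} := measurable_pi_apply 0 hB
  have hF : Measurable
      ({X : Config (n + 1) | X 0 ∈ B}.indicator fun X => (‖Ψ X‖₊ : ℝ≥0∞) ^ 2) :=
    (hΨ.nnnorm.coe_nnreal_ennreal.pow_const 2).indicator hS0
  rw [← lintegral_indicator hS0, lintegral_config_succ hF]
  refine lintegral_congr fun Y => ?_
  rw [← lintegral_indicator hB]
  refine lintegral_congr fun x => ?_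
  by_cases hx : x ∈ B
  · have hx' : Matrix.vecCons x Y ∈ {X : Config (n + 1) | X 0 ∈ B} := by
      simpa only [Set.mem_setOf_eq, Matrix.cons_val_zero] using hx
    rw [Set.indicator_of_mem hx, Set.indicator_of_mem hx']
  · have hx' : Matrix.vecCons x Y ∉ {X : Config (n + 1) | X 0 ∈ B} := by
      simpa only [Set.mem_setOf_eq, Matrix.cons_val_zero] using hx
    rw [Set.indicator_of_notMem hx, Set.indicator_of_notMem hx']

/-- **Cauchy–Schwarz in the cell.** For a measurable `(n+1)`-body `Ψ`, the occupation of the flat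
mode of the cell `B = dyCell L K i` is at most `(n+1) ∫_{X 0 ∈ B} |Ψ|²`: slice-wise
`|(s³)^{-1/2} ∫_B Ψ(x,Y) dx|² ≤ ∫_B |Ψ(x,Y)|² dx` (`|B| = s³`), then Tonelli over the first particle;
for `L ≤ 0` the mode and the occupation vanish. [cite: LSSY2005, §1.2 (1.17)] -/
theorem occupation_dyMode_le_mul_setLIntegral {n : ℕ} (L : ℝ) (K : ℕ) (i : Fin 3 → Fin (2 ^ K))
    {Ψ : Config (n + 1) → ℂ} (hΨ : Measurable Ψ) :
    occupation (n + 1) (dyMode L K i) Ψ ≤ (n + 1 : ℝ≥0∞) *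
      ∫⁻ X in {X : Config (n + 1) | X 0 ∈ dyCell L K i}, (‖Ψ X‖₊ : ℝ≥0∞) ^ 2 := by
  rcases le_or_gt L 0 with hL | hL
  · have h0 : dyMode L K i = fun _ => 0 := by
      rw [dyMode, dyCell_eq_empty hL, Set.indicator_empty]
    simp [occupation_succ, h0]
  have hs : 0 < L / 2 ^ K := by positivity
  rw [occupation_succ, ← lintegral_setLIntegral_vecCons hΨ (measurableSet_dyCell L K i)]
  refine mul_le_mul_right (lintegral_mono fun Y => ?_) _
  -- adapted from the `hcell` step of `sum_nnnorm_cellAverage_sq_le`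
  have hmeasY : Measurable fun x : Space => Ψ (Matrix.vecCons x Y) :=
    hΨ.comp ((measurable_vecCons_fst_snd n).comp (measurable_id.prodMk measurable_const))
  rw [integral_conj_dyMode_mul, nnnorm_mul, ENNReal.coe_mul, mul_pow, nnnorm_flatAmp_sq hs]
  calc ENNReal.ofReal (((L / 2 ^ K) ^ 3)⁻¹) *
        ((‖∫ x in dyCell L K i, Ψ (Matrix.vecCons x Y)‖₊ : ℝ≥0∞) ^ 2)
      ≤ ENNReal.ofReal (((L / 2 ^ K) ^ 3)⁻¹) * (volume (dyCell L K i) *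
          ∫⁻ x in dyCell L K i, (‖Ψ (Matrix.vecCons x Y)‖₊ : ℝ≥0∞) ^ 2) := by
        gcongr
        simpa only [Measure.restrict_apply_univ] using
          nnnorm_integral_sq_le_mul_lintegral (volume.restrict (dyCell L K i)) hmeasY.aemeasurable
    _ = ∫⁻ x in dyCell L K i, (‖Ψ (Matrix.vecCons x Y)‖₊ : ℝ≥0∞) ^ 2 := by
        rw [volume_dyCell, ← mul_assoc, ← ENNReal.ofReal_pow hs.le,
          ← ENNReal.ofReal_mul (by positivity), inv_mul_cancel₀ (by positivity), ENNReal.ofReal_one,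
          one_mul]

/-- **A flat-mode occupation is at most the expected number of particles in its cell.**
`⟨φ_B, γ_Ψ φ_B⟩ ≤ Σ_j ∫_{x_j ∈ B} |Ψ|²` for every Dirichlet trial state `Ψ`, every level `K` and every
half-open dyadic cell `B = dyCell L K i` (Cauchy–Schwarz against the normalised flat mode in the cube,
then Bose symmetry to pass from particle `0` to every particle `j`). [cite: LSSY2005, §1.2 (1.17)] -/
theorem stub_occupationLeDensity : ∀ (N : ℕ) (L : ℝ) (Ψ : TrialState N L) (K : ℕ)
    (i : Fin 3 → Fin (2 ^ K)),
    occupation N (dyMode L K i) Ψ.ψ ≤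
      ∑ j : Fin N, ∫⁻ X in {X : Config N | X j ∈ dyCell L K i}, (‖Ψ.ψ X‖₊ : ℝ≥0∞) ^ 2 := by
  intro N L Ψ K i
  cases N with
  | zero => simp [occupation]
  | succ n =>
    have hΨ : Measurable Ψ.ψ := Ψ.contDiff.continuous.measurable
    calc occupation (n + 1) (dyMode L K i) Ψ.ψ
        ≤ (n + 1 : ℝ≥0∞) *
            ∫⁻ X in {X : Config (n + 1) | X 0 ∈ dyCell L K i}, (‖Ψ.ψ X‖₊ : ℝ≥0∞) ^ 2 :=
          occupation_dyMode_le_mul_setLIntegral L K i hΨ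
      _ = ∑ _j : Fin (n + 1),
            ∫⁻ X in {X : Config (n + 1) | X 0 ∈ dyCell L K i}, (‖Ψ.ψ X‖₊ : ℝ≥0∞) ^ 2 := by
          rw [Finset.sum_const, Finset.card_univ, Fintype.card_fin, nsmul_eq_mul, Nat.cast_succ]
      _ = ∑ j : Fin (n + 1),
            ∫⁻ X in {X : Config (n + 1) | X j ∈ dyCell L K i}, (‖Ψ.ψ X‖₊ : ℝ≥0∞) ^ 2 :=
          Finset.sum_congr rfl fun j _ =>
            (setLIntegral_coord_mem_eq Ψ.symm (measurableSet_dyCell L K i) j).symm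

end Summit.AtomisticToContinuum.BoseEinsteinCondensation.Theorems.BaseCoherentMass

end
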